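import Summits.BirchSwinnertonDyer.Rank1Residual.Additive.TameBranchLambdaParityRankZero
import Summits.BirchSwinnertonDyer.Rank1Residual.Additive.TameBranchExtraZerosRankZeroCertificate
import HarnessLib

/-!
# THE PARITY OF `λ` ON THE TAME BRANCH at rank zero, defect 3, 4, 6 from PRINT: `λ(X)` even,
# `μ(X) + 2t ≤ ord Ш[p^∞] + ord ∏c + ord ℓ ≤ μ(X) + ord_p[0]⁺_f + c + 2t`, the dichotomy at `λ_an = 2`
# from two values, and the squeeze `μ(X) ≤ m ∧ m + 2t < ord_p ∏c` ⟹ the main conjecture AT THE PAIR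
# (cell `b2b-bsdres`, sub-cell additive-p2 = X3♯(G-ord)/X4♯(G-ord), gen 30; part 5)

HONEST FRAMING (cell `b2b-bsdres`, run/shared/lean/b2b/bsd-rank1-residual/, verbatim in every
file): the goal of the cell is to DELETE the COMBINATION-SHAPED residual classes of the
Birch–Swinnerton-Dyer formula for ALL analytic-rank `≤ 1` elliptic curves over `ℚ` — "full BSD
formula for every rank `≤ 1` curve in class `C`" assembled STRICTLY from published theorems — so
that the rank-`≤ 1` remainder becomes exactly the CONSTRUCTION-SHAPED classes, which are TYPED
(missing-input `Prop`s), NOT attempted. This is not "finishing BSD". Sub-cell additive-p2: the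
classes X3♯(G-ord) / X4♯(G-ord) are CONSTRUCTION-SHAPED and stay so; labels / RESIDUAL-MAP marks
UNCHANGED; nothing is booked. Theorems only; published inputs are hypothesis binders (A282 = Delbourgo
1998 Thm 1, A175/A227 = Delbourgo 2002 (A)(B)/(C), Greenberg 1999 Prop. 3.10
`prop310_selmerCorank_mod_two_eq_lambdaInvariant`). No definition, no named fact, no `sorry`.

## What and why

Part 3 proved per datum, at `rank_ℤ E(ℚ) = 0`, the two-sided sandwich with parity. Here the tuple comes
from PRINT (Delbourgo 1998 Thm 1: THE tame branch exists, sign irrelevant for the inequalities) and the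
first top from TWO values, type-free (gen 29 §9):

* §10 **`sandwich_rankZero_of_thm1`** — `p ≥ 5`, non-CM, ADDITIVE, (G)-ordinary, `e ∈ {3,4,6}`, `rank 0`,
  `[0]⁺_f ≠ 0`, tower bound `p^c`: for every (B)-datum and cyclotomic dual datum with generator `fE`:
  `#Ш[p^∞] < ∞`, **`λ(fE)` EVEN**, **`μ(fE) + 2t ≤ LHS ≤ μ(fE) + ord_p[0]⁺_f + c + 2t`** (left `=` iff
  `λ(fE) = 0`), and the squeeze **`μ(fE) ≤ m ∧ m + 2t < ord_p ∏c ⟹ 2 ≤ λ(fE)`** — NO twisted value;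
* §10 **`exists_sandwich_rankZero_of_thm1_of_two_norm_ratTwistedSymbolSum`** — plus TWO values on one line
  `t ∈ {1, e−1}` with common `k`: a TYPE-FREE witness `(ã₀, B)` with first top `k` EXISTS, `λ(fE) ≤ k`,
  right `=` iff `λ(fE) = k`, at `k = 2` the DICHOTOMY `λ(fE) ∈ {0, 2}`, and the squeeze gives **`λ(fE) = 2`,
  `LHS = μ(fE) + ord_p[0]⁺_f + c + 2t`, and `char_Λ X = (G)` with `ι G = p^{μ(fE)+c}·B`** — Delbourgo's
  main conjecture (G) at the pair, rationally, exponent `μ(X) + c`;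
* §11 X4♯(G-ord): `c = 0` (Drinfeld–Manin), `p ∤ #E(ℚ)_tors`: the squeeze hypothesis is
  **`μ(X) ≤ m < ord_p ∏c_ℓ`**, with `m = 0`: `μ(X) = 0 ∧ p ∣ ∏c_ℓ`.

Window reading (EVIDENCE, gen 27 (R2) + Cremona; nothing booked): all nine X4-3 window rows with
`p ∣ [0]⁺_f` have `p ∥ ∏c_ℓ`, `p ∤ #tors`, `#Ш_an = 1`; eight have `λ_an = 2`: there `μ(X(E/ℚ_∞)) = 0`
ALONE forces `λ(X) = 2` (two extra algebraic zeros at rank zero), the main conjecture (G) at the pair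
with `char_Λ X = (ι⁻¹ B_E)` INTEGRALLY, and `ord Ш[p^∞] + ord ℓ = 0` (consistent with `#Ш_an = 1`); on
7350ca1@5 (`λ_an = 4`) it forces `λ(X) ∈ {2, 4}`. Not given: `μ`; a booking.

References: [Delbourgo1998] Thm. 1; [Delbourgo2002] Thm. (A)(B)(C); [GreenbergLNM1716] Prop. 3.10, §5
p. 183; [GreenbergVatsal2000] p. 4; [Lang1990] Ch. 1 §2 Thm. 2.1; [Manin1972] Cor. 3.6;
[MazurTateTeitelbaum1986Invent] §I.8, §I.13–I.14, §II.4; [Washington1997] §7.1. -/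

set_option autoImplicit false

noncomputable section

open scoped Classical MatrixGroups ModularForm NumberField

open CongruenceSubgroup IsDedekindDomain WeierstrassCurve NumberField
  Literature.NumberTheory.EllipticCurves
  Literature.NumberTheory.EllipticCurves.ModularForms
  Literature.NumberTheory.EllipticCurves.Rank1Residual
  Literature.NumberTheory.EllipticCurves.Rank1Residual.Typed
  Literature.NumberTheory.EllipticCurves.Delbourgo2002
  Literature.NumberTheory.EllipticCurves.Greenberg1999
  Summit.BirchSwinnertonDyer.Rank1Residual.X1.MuLambda
  Summit.BirchSwinnertonDyer.Rank1Residual.X1.ParitySqueeze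
  Summit.BirchSwinnertonDyer.Rank1Residual.X1.RankOneParitySqueeze
  Summit.BirchSwinnertonDyer.Rank1Residual.X11a.LambdaNorm

namespace Summit.BirchSwinnertonDyer.Rank1Residual.Additive

/-! ### §10 Rank zero on defect 3, 4, 6 from PRINT: parity, sandwich, squeeze; two values for the
dichotomy and the main conjecture at the pair -/

namespace TwistPartner

open TameBranchOneValue TameBranchTwoValue TameBranchExtraZeros TameBranchLambdaParity

section ZeroJoin

variable {W : WeierstrassCurve ℚ} [W.IsElliptic] [W.IsGloballyMinimal] {p : ℕ} [hp : Fact p.Prime]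
  {N : ℕ} [NeZero N] {f : CuspForm (Gamma0 N) 2} {χ : MulChar (ZMod p) ℚ_[p]}

/-- **RANK ZERO FROM PRINT + ONE RATIONAL NUMBER: parity, two-sided sandwich, squeeze.** `p ≥ 5`,
non-CM, ADDITIVE, (G)-ordinary, `e ∈ {3,4,6}`, `rank_ℤ E(ℚ) = 0`; Delbourgo 1998 Thm 1, 2002 (A)(B)(C),
Greenberg Prop. 3.10; tower bound `p^c`; `[0]⁺_f ≠ 0`. For every (B)-datum and every cyclotomic dual
datum with generator `fE`: `#Ш[p^∞] < ∞`, **`λ(fE)` EVEN**, `λ(fE) = 0 ∨ 2 ≤ λ(fE)`,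
**`μ(fE) + 2t ≤ LHS`** (`=` iff `λ(fE) = 0`), `LHS ≤ μ(fE) + ord_p[0]⁺_f + c + 2t`, and
**`μ(fE) ≤ m`, `m + 2t < ord_p ∏c ⟹ 2 ≤ λ(fE)`**. NO twisted value. [cite: Delbourgo1998, Theorem 1 (p. 131)]
[cite: Delbourgo2002, Theorem (A), (B), (C) (p. 40)] [cite: GreenbergLNM1716, Prop. 3.10]
[cite: MazurTateTeitelbaum1986Invent, §II.4] [cite: Washington1997, §7.1] -/
theorem sandwich_rankZero_of_thm1 (h310 : prop310_selmerCorank_mod_two_eq_lambdaInvariant)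
    (hD : Delbourgo1998.thm1_exists_bounded_evenMeasure)
    (hC : Delbourgo2002.thmC_charIdeal_dvd_tameBranch) (hDel : Delbourgo2002.mainTheorem)
    (hDelM : Delbourgo2002.mainTheorem_potMult) (h5 : 5 ≤ p) (hcm : ¬ W.HasCM) (hadd : Addv W p)
    (hGord : TypeGOrd W p) (he : semistabilityIndex W p ∈ ({3, 4, 6} : Finset ℕ))
    (hr0 : W.mordellWeilRank = 0) (hf : IsNewformOf W f) {c : ℕ}
    (hc : ∀ (m : ℕ) (a : ℤ), ‖((ratPlusSymbol f ((a : ℚ) / (p : ℚ) ^ m) : ℚ) : ℚ_[p])‖ ≤ (p : ℝ) ^ c)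
    (h0 : ratPlusSymbol f 0 ≠ 0) {Dh : PAdicHeightData W p} (hBcl : LeadingTermClauses W p Dh)
    {K : ZpExtension ℚ p} {γ : Field.absoluteGaloisGroup ℚ}
    (hK : K.IsCyclotomic) (hγ : K.IsTopGenerator γ) (hcv : IsCyclotomicVariable p γ)
    (D : W.SelmerDualData K γ) [Module.Finite (IwasawaAlgebra p) D.X]
    {fE : IwasawaAlgebra p} (hchar : D.charIdeal = Ideal.span {fE}) :
    Finite (AddCommGroup.primaryComponent W.sha p) ∧ Even (X1.MuLambda.lam fE) ∧
      (X1.MuLambda.lam fE = 0 ∨ 2 ≤ X1.MuLambda.lam fE) ∧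
      ∃ ℓ : ℕ, ℓ ∣ p ^ 2 ∧ (ReductionNonAnomalous W p → ℓ = 1) ∧
        (X1.MuLambda.mu fE : ℤ) + 2 * padicValNat p W.torsionOrder ≤
          (padicValNat p (Nat.card (AddCommGroup.primaryComponent W.sha p)) : ℤ) +
            (padicRegulator Dh).valuation + padicValNat p W.tamagawaProduct + padicValNat p ℓ ∧
        ((X1.MuLambda.mu fE : ℤ) + 2 * padicValNat p W.torsionOrder =
          (padicValNat p (Nat.card (AddCommGroup.primaryComponent W.sha p)) : ℤ) +
            (padicRegulator Dh).valuation + padicValNat p W.tamagawaProduct + padicValNat p ℓ ↔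
          X1.MuLambda.lam fE = 0) ∧
        (padicValNat p (Nat.card (AddCommGroup.primaryComponent W.sha p)) : ℤ) +
            (padicRegulator Dh).valuation + padicValNat p W.tamagawaProduct + padicValNat p ℓ ≤
          X1.MuLambda.mu fE + padicValRat p (ratPlusSymbol f 0) + c + 2 * padicValNat p W.torsionOrder ∧
        ∀ m : ℕ, X1.MuLambda.mu fE ≤ m → m + 2 * padicValNat p W.torsionOrder < padicValNat p W.tamagawaProduct →
          2 ≤ X1.MuLambda.lam fE := by
  have hp2 : p ≠ 2 := by omega
  have hT : TameBranchRatDvdAt W p := tameBranchRatDvdAt_of_thmC hC hDel hDelM h5 hcm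
  obtain ⟨χ₀, ã₀, B, hord0, hã₀, hB, hint⟩ := exists_isTameBranchOf_of_thm1 hD h5 hadd hGord he hf
  obtain ⟨hfin, heven, hpar, ℓ, hℓ, hna, hlow, hlowiff, hup, hsq, -⟩ := sandwich_rankZero_of_tameBranchRatDvdAt
    h310 hT hp2 hadd (Or.inr hGord) hf hord0 hã₀ hB (hint _ hc) h0 hr0 hBcl hK hγ hcv D hchar
  refine ⟨hfin, heven, hpar, ℓ, hℓ, hna, hlow, hlowiff, hup, fun m hμ hb ↦ hsq ?_⟩
  haveI : Finite (AddCommGroup.primaryComponent W.sha p) := hfin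
  haveI : Finite W.toAffine.Point := W.mordellWeilRank_eq_zero_iff_finite.mp hr0
  have hReg : (padicRegulator Dh).valuation = 0 := by
    rw [padicRegulator_eq_one_of_finite W p Dh, Padic.valuation_one]
  have hSh : (0 : ℤ) ≤ padicValNat p (Nat.card (AddCommGroup.primaryComponent W.sha p)) := by
    exact_mod_cast Nat.zero_le _
  have hℓv : (0 : ℤ) ≤ padicValNat p ℓ := by exact_mod_cast Nat.zero_le _
  have hμ' : (X1.MuLambda.mu fE : ℤ) ≤ m := by exact_mod_cast hμ
  have hb' : (m : ℤ) + 2 * padicValNat p W.torsionOrder < padicValNat p W.tamagawaProduct := by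
    exact_mod_cast hb
  linarith

/-- **RANK ZERO FROM PRINT + TWO VALUES: the type-free witness, the dichotomy at `λ_an = 2`, and the
squeeze ⟹ THE MAIN CONJECTURE AT THE PAIR.** Same locus; `χ = ω^u`; TWO values on one line `t ∈ {1, e−1}`
with common `k`, `e·k < 2φₙ`. Then `ã₀` (`‖ã₀‖ = 1`) and `B` with `IsTameBranchOf f p (ι∘χ^t) ã₀ B`, bounded
by `p^c`, FIRST top at `k` EXIST (gen 29 §9), and for every (B)-datum and cyclotomic dual datum with
generator `fE`: `X` torsion, `#Ш[p^∞] < ∞`, **`λ(fE)` EVEN, `λ(fE) ≤ k`**, the two-sided sandwich (left `=`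
iff `λ(fE) = 0`, right `=` iff `λ(fE) = k`), at `k = 2` the dichotomy `λ(fE) ∈ {0,2}`, and
**`μ(fE) ≤ m`, `m + 2t < ord_p ∏c ⟹ 2 ≤ λ(fE)`, and at `k = 2`: `λ(fE) = 2`,
`LHS = μ(fE) + ord_p[0]⁺_f + c + 2t`, `char_Λ X = (G)` with `ι G = p^{μ(fE)+c}·B`**. Nothing booked.
[cite: Delbourgo1998, Theorem 1 (p. 131)] [cite: Delbourgo2002, Theorem (A), (B), (C) (p. 40)]
[cite: GreenbergLNM1716, Prop. 3.10 and §5 p. 183] [cite: GreenbergVatsal2000, p. 4]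
[cite: Lang1990, Ch. 1 §2 Thm. 2.1] [cite: Washington1997, §7.1] -/
theorem exists_sandwich_rankZero_of_thm1_of_two_norm_ratTwistedSymbolSum
    (h310 : prop310_selmerCorank_mod_two_eq_lambdaInvariant)
    (hD : Delbourgo1998.thm1_exists_bounded_evenMeasure)
    (hC : Delbourgo2002.thmC_charIdeal_dvd_tameBranch) (hDel : Delbourgo2002.mainTheorem)
    (hDelM : Delbourgo2002.mainTheorem_potMult) (h5 : 5 ≤ p) (hcm : ¬ W.HasCM) (hadd : Addv W p)
    (hGord : TypeGOrd W p) (he : semistabilityIndex W p ∈ ({3, 4, 6} : Finset ℕ))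
    (hr0 : W.mordellWeilRank = 0) (hf : IsNewformOf W f) (hχe : orderOf χ = semistabilityIndex W p)
    {u : ℕ} (hu : semistabilityIndex W p * u = p - 1)
    (hteich : ∀ a : ZMod p, a ≠ 0 → ‖χ a - ((a.val : ℕ) : ℚ_[p]) ^ u‖ < 1) {c : ℕ}
    (hc : ∀ (m : ℕ) (a : ℤ), ‖((ratPlusSymbol f ((a : ℚ) / (p : ℚ) ^ m) : ℚ) : ℚ_[p])‖ ≤ (p : ℝ) ^ c)
    (h0 : ratPlusSymbol f 0 ≠ 0)
    {n : ℕ} {κ : DirichletCharacter ℂ_[p] (p ^ (n + 1 + cyclotomicExponent p))} (hκ : κ.IsPrimitive)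
    (heven : κ.Even) (hord : ∃ j : ℕ, orderOf κ = p ^ j)
    {κ' : DirichletCharacter ℂ_[p] (p ^ (n + 1 + 1 + cyclotomicExponent p))} (hκ' : κ'.IsPrimitive)
    (heven' : κ'.Even) (hord' : ∃ j : ℕ, orderOf κ' = p ^ j) {k t : ℕ}
    (ht : t = 1 ∨ t = semistabilityIndex W p - 1)
    (hk2 : semistabilityIndex W p * k < 2 * Nat.totient (p ^ (n + 1)))
    (hval : ‖ratTwistedSymbolSum f κ‖ ^ (semistabilityIndex W p * Nat.totient (p ^ (n + 1))) =
      ((p : ℝ) ^ c) ^ (semistabilityIndex W p * Nat.totient (p ^ (n + 1))) *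
        ((p : ℝ)⁻¹) ^ (semistabilityIndex W p * k + t * Nat.totient (p ^ (n + 1))))
    (hval' : ‖ratTwistedSymbolSum f κ'‖ ^ (semistabilityIndex W p * Nat.totient (p ^ (n + 1 + 1))) =
      ((p : ℝ) ^ c) ^ (semistabilityIndex W p * Nat.totient (p ^ (n + 1 + 1))) *
        ((p : ℝ)⁻¹) ^ (semistabilityIndex W p * k + t * Nat.totient (p ^ (n + 1 + 1)))) :
    ∃ (ã₀ : ℚ_[p]) (B : PowerSeries ℚ_[p]), ‖ã₀‖ = 1 ∧
      IsTameBranchOf f p ((χ ^ t).ringHomComp (algebraMap ℚ_[p] ℂ_[p])) ã₀ B ∧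
      (∀ j : ℕ, ‖PowerSeries.coeff j B‖ ≤ (p : ℝ) ^ c) ∧
      ‖PowerSeries.coeff k B‖ = (p : ℝ) ^ c ∧ (∀ i < k, ‖PowerSeries.coeff i B‖ < (p : ℝ) ^ c) ∧
    ∀ (Dh : PAdicHeightData W p), LeadingTermClauses W p Dh →
      ∀ (K : ZpExtension ℚ p) (γ : Field.absoluteGaloisGroup ℚ),
        K.IsCyclotomic → K.IsTopGenerator γ → IsCyclotomicVariable p γ →
        ∀ (D : W.SelmerDualData K γ) (fE : IwasawaAlgebra p), D.charIdeal = Ideal.span {fE} →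
          D.IsTorsion ∧ Finite (AddCommGroup.primaryComponent W.sha p) ∧ Even (X1.MuLambda.lam fE) ∧
          X1.MuLambda.lam fE ≤ k ∧
          ∃ ℓ : ℕ, ℓ ∣ p ^ 2 ∧ (ReductionNonAnomalous W p → ℓ = 1) ∧
            (X1.MuLambda.mu fE : ℤ) + 2 * padicValNat p W.torsionOrder ≤
              (padicValNat p (Nat.card (AddCommGroup.primaryComponent W.sha p)) : ℤ) +
                (padicRegulator Dh).valuation + padicValNat p W.tamagawaProduct + padicValNat p ℓ ∧
            ((X1.MuLambda.mu fE : ℤ) + 2 * padicValNat p W.torsionOrder =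
              (padicValNat p (Nat.card (AddCommGroup.primaryComponent W.sha p)) : ℤ) +
                (padicRegulator Dh).valuation + padicValNat p W.tamagawaProduct + padicValNat p ℓ ↔
              X1.MuLambda.lam fE = 0) ∧
            (padicValNat p (Nat.card (AddCommGroup.primaryComponent W.sha p)) : ℤ) +
                (padicRegulator Dh).valuation + padicValNat p W.tamagawaProduct + padicValNat p ℓ ≤
              X1.MuLambda.mu fE + padicValRat p (ratPlusSymbol f 0) + c + 2 * padicValNat p W.torsionOrder ∧
            ((padicValNat p (Nat.card (AddCommGroup.primaryComponent W.sha p)) : ℤ) +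
                (padicRegulator Dh).valuation + padicValNat p W.tamagawaProduct + padicValNat p ℓ =
              X1.MuLambda.mu fE + padicValRat p (ratPlusSymbol f 0) + c + 2 * padicValNat p W.torsionOrder ↔
              X1.MuLambda.lam fE = k) ∧
            (k = 2 → X1.MuLambda.lam fE = 0 ∨ X1.MuLambda.lam fE = 2) ∧
            ∀ m : ℕ, X1.MuLambda.mu fE ≤ m →
              m + 2 * padicValNat p W.torsionOrder < padicValNat p W.tamagawaProduct →
              2 ≤ X1.MuLambda.lam fE ∧
              (k = 2 → X1.MuLambda.lam fE = 2 ∧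
                (padicValNat p (Nat.card (AddCommGroup.primaryComponent W.sha p)) : ℤ) +
                  (padicRegulator Dh).valuation + padicValNat p W.tamagawaProduct + padicValNat p ℓ =
                X1.MuLambda.mu fE + padicValRat p (ratPlusSymbol f 0) + c + 2 * padicValNat p W.torsionOrder ∧
                ∃ G : IwasawaAlgebra p, D.charIdeal = Ideal.span {G} ∧
                  iwasawaToPowerSeries p G =
                    PowerSeries.C ((p : ℚ_[p]) ^ (X1.MuLambda.mu fE + c)) * B) := by
  have hp2 : p ≠ 2 := by omega
  have hG : SubGord W p := (subGord_iff_typeG_of_addv W p hp2 hadd).mpr hGord.typeG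
  have hT : TameBranchRatDvdAt W p := tameBranchRatDvdAt_of_thmC hC hDel hDelM h5 hcm
  obtain ⟨ã₀, B, hã₀, hB, hint, hk, hlt⟩ :=
    exists_isTameBranchOf_pow_firstTop_of_thm1_of_two_norm_ratTwistedSymbolSum hD h5 hadd hGord he hf hχe hu
      hteich hc hκ heven hord hκ' heven' hord' ht hk2 hval hval'
  have hbd : ∀ j : ℕ, ‖PowerSeries.coeff j B‖ ≤ (p : ℝ) ^ c := hint _ hc
  have hordt : orderOf (χ ^ t) = semistabilityIndex W p :=
    orderOf_pow_eq_of_mem hχe (by have := three_le_of_mem he; omega) ht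
  have hordε : orderOf ((χ ^ t).ringHomComp (algebraMap ℚ_[p] ℂ_[p])) = tameDefect W p := by
    rw [orderOf_ringHomComp_padicComplex, hordt, tameDefect_of_not_potMult W p hG.1]
  refine ⟨ã₀, B, hã₀, hB, hbd, hk, hlt, fun Dh hBcl K γ hK hγ hcv D fE hchar ↦ ?_⟩
  haveI : Module.Finite (IwasawaAlgebra p) D.X := D.module_finite_holds hγ
  obtain ⟨hX, g, hg, k₀, hι⟩ := hT _ ã₀ B hp2 hadd (Or.inr hGord) hK hγ hcv hf hordε hã₀ hB D
  have h0Q : ((ratPlusSymbol f 0 : ℚ) : ℚ_[p]) ≠ 0 := by exact_mod_cast h0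
  have hα0 : ã₀ ≠ 0 := by intro e; rw [e, norm_zero] at hã₀; exact zero_ne_one hã₀
  have hB0' : PowerSeries.constantCoeff B = ã₀⁻¹ * ((ratPlusSymbol f 0 : ℚ) : ℚ_[p]) := hB.constantCoeff
  have hB0 : PowerSeries.constantCoeff B ≠ 0 := by
    rw [hB0']; exact mul_ne_zero (inv_ne_zero hα0) h0Q
  have hvB : (PowerSeries.constantCoeff B).valuation = padicValRat p (ratPlusSymbol f 0) := by
    have hαv : (ã₀⁻¹).valuation = 0 := by
      have h1 : ‖ã₀⁻¹‖ = (p : ℝ) ^ (0 : ℕ) := by rw [norm_inv, hã₀, inv_one, pow_zero]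
      have := (norm_eq_pow_iff_valuation_eq (inv_ne_zero hα0) 0).mp h1
      simpa using this
    rw [hB0', Padic.valuation_mul (inv_ne_zero hα0) h0Q, hαv, zero_add, Padic.valuation_ratCast]
  obtain ⟨-, hfin, hev, -, ℓ, hℓ, hna, hlow, hlowiff, hup, hsq, hrest⟩ :=
    sandwich_rankZero_of_iota_eq h310 hp2 hr0 hBcl hK hγ hcv D hX hchar hg hι hbd hB0
  obtain ⟨hlamk, hupiff, hdich, hsq2⟩ := hrest k hk hlt
  rw [hvB] at hup hupiff hsq2
  refine ⟨hX, hfin, hev, hlamk, ℓ, hℓ, hna, hlow, hlowiff, hup, hupiff, hdich, fun m hμ hb ↦ ?_⟩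
  haveI : Finite (AddCommGroup.primaryComponent W.sha p) := hfin
  haveI : Finite W.toAffine.Point := W.mordellWeilRank_eq_zero_iff_finite.mp hr0
  have hReg : (padicRegulator Dh).valuation = 0 := by
    rw [padicRegulator_eq_one_of_finite W p Dh, Padic.valuation_one]
  have hSh : (0 : ℤ) ≤ padicValNat p (Nat.card (AddCommGroup.primaryComponent W.sha p)) := by
    exact_mod_cast Nat.zero_le _
  have hℓv : (0 : ℤ) ≤ padicValNat p ℓ := by exact_mod_cast Nat.zero_le _
  have hμ' : (X1.MuLambda.mu fE : ℤ) ≤ m := by exact_mod_cast hμ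
  have hb' : (m : ℤ) + 2 * padicValNat p W.torsionOrder < padicValNat p W.tamagawaProduct := by
    exact_mod_cast hb
  have hstrict : (X1.MuLambda.mu fE : ℤ) + 2 * padicValNat p W.torsionOrder <
      (padicValNat p (Nat.card (AddCommGroup.primaryComponent W.sha p)) : ℤ) +
        (padicRegulator Dh).valuation + padicValNat p W.tamagawaProduct + padicValNat p ℓ := by
    linarith
  refine ⟨hsq hstrict, fun hk2' ↦ ?_⟩
  subst hk2'
  obtain ⟨hlam2, heq⟩ := hsq2 rfl hstrict
  obtain ⟨-, G, hGspan, -, -, hιG⟩ := charIdeal_eq_span_and_iota_eq_of_squeeze_rankZero h310 hp2 hr0 hBcl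
    hK hγ hcv D hX hchar hg hι hbd hB0 hk hlt hμ hb
  exact ⟨hlam2, heq, G, hGspan, hιG⟩

end ZeroJoin

/-! ### §11 X4♯(G-ord): `c = 0` (Drinfeld–Manin), the squeeze hypothesis is `μ(X) ≤ m < ord_p ∏c_ℓ` -/

section ClassX4

variable {W : WeierstrassCurve ℚ} [W.IsElliptic] [W.IsGloballyMinimal] {p : ℕ} [hp : Fact p.Prime]
  {N : ℕ} [NeZero N] {f : CuspForm (Gamma0 N) 2} {χ : MulChar (ZMod p) ℚ_[p]}

/-- **X4♯(G-ord), defect 3, 4, 6, `rank_ℤ E(ℚ) = 0`, `p ≥ 5`, non-CM — PARITY, SANDWICH AND SQUEEZE FROM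
PRINT + `ord_p[0]⁺_f`** (`c = 0`): for every (B)-datum and cyclotomic dual datum with generator `fE`:
`#Ш[p^∞] < ∞`, **`λ(fE)` EVEN**, **`μ(fE) + 2t ≤ ord_p #Ш[p^∞] + ord_p Reg_p + ord_p ∏c + ord_p ℓ ≤ μ(fE) +
ord_p[0]⁺_f + 2t`** (left `=` iff `λ(fE) = 0`), and **`μ(fE) ≤ m`, `m + 2t < ord_p ∏c_ℓ ⟹ 2 ≤ λ(fE)`**
(`t = ord_p #E(ℚ)_tors = 0` for irreducible `E[p]`, `p ≥ 5`, not used). Nothing booked; X4♯(G-ord)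
stays CONSTRUCTION-SHAPED. [cite: Delbourgo1998, Theorem 1 (p. 131)]
[cite: Delbourgo2002, Theorem (A), (B), (C) (p. 40)] [cite: GreenbergLNM1716, Prop. 3.10 and §5 p. 183]
[cite: Manin1972, Cor. 3.6] [cite: Washington1997, §7.1] -/
theorem ClassX4Gord.sandwich_rankZero_of_thm1 (h310 : prop310_selmerCorank_mod_two_eq_lambdaInvariant)
    (hD : Delbourgo1998.thm1_exists_bounded_evenMeasure)
    (hC : Delbourgo2002.thmC_charIdeal_dvd_tameBranch) (hDel : Delbourgo2002.mainTheorem)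
    (hDelM : Delbourgo2002.mainTheorem_potMult) (hX : ClassX4Gord W p) (h5 : 5 ≤ p) (hcm : ¬ W.HasCM)
    (he : semistabilityIndex W p ∈ ({3, 4, 6} : Finset ℕ)) (hr0 : W.mordellWeilRank = 0)
    (hf : IsNewformOf W f) (h0 : ratPlusSymbol f 0 ≠ 0)
    {Dh : PAdicHeightData W p} (hBcl : LeadingTermClauses W p Dh)
    {K : ZpExtension ℚ p} {γ : Field.absoluteGaloisGroup ℚ}
    (hK : K.IsCyclotomic) (hγ : K.IsTopGenerator γ) (hcv : IsCyclotomicVariable p γ)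
    (D : W.SelmerDualData K γ) [Module.Finite (IwasawaAlgebra p) D.X]
    {fE : IwasawaAlgebra p} (hchar : D.charIdeal = Ideal.span {fE}) :
    Finite (AddCommGroup.primaryComponent W.sha p) ∧ Even (X1.MuLambda.lam fE) ∧
      (X1.MuLambda.lam fE = 0 ∨ 2 ≤ X1.MuLambda.lam fE) ∧
      ∃ ℓ : ℕ, ℓ ∣ p ^ 2 ∧ (ReductionNonAnomalous W p → ℓ = 1) ∧
        (X1.MuLambda.mu fE : ℤ) + 2 * padicValNat p W.torsionOrder ≤
          (padicValNat p (Nat.card (AddCommGroup.primaryComponent W.sha p)) : ℤ) +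
            (padicRegulator Dh).valuation + padicValNat p W.tamagawaProduct + padicValNat p ℓ ∧
        ((X1.MuLambda.mu fE : ℤ) + 2 * padicValNat p W.torsionOrder =
          (padicValNat p (Nat.card (AddCommGroup.primaryComponent W.sha p)) : ℤ) +
            (padicRegulator Dh).valuation + padicValNat p W.tamagawaProduct + padicValNat p ℓ ↔
          X1.MuLambda.lam fE = 0) ∧
        (padicValNat p (Nat.card (AddCommGroup.primaryComponent W.sha p)) : ℤ) +
            (padicRegulator Dh).valuation + padicValNat p W.tamagawaProduct + padicValNat p ℓ ≤
          X1.MuLambda.mu fE + padicValRat p (ratPlusSymbol f 0) + 2 * padicValNat p W.torsionOrder ∧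
        ∀ m : ℕ, X1.MuLambda.mu fE ≤ m → m + 2 * padicValNat p W.torsionOrder < padicValNat p W.tamagawaProduct →
          2 ≤ X1.MuLambda.lam fE := by
  have hc : ∀ (m : ℕ) (a : ℤ),
      ‖((ratPlusSymbol f ((a : ℚ) / (p : ℚ) ^ m) : ℚ) : ℚ_[p])‖ ≤ (p : ℝ) ^ (0 : ℕ) := fun m a ↦ by
    rw [pow_zero]
    exact plusSymbolsPIntegralAt_of_classX4 W p hX.1 f hf _
  have h := TwistPartner.sandwich_rankZero_of_thm1 h310 hD hC hDel hDelM h5 hcm hX.addv.2 hX.typeGOrd he hr0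
    hf hc h0 hBcl hK hγ hcv D hchar
  simp only [Nat.cast_zero, add_zero] at h
  exact h

end ClassX4

end TwistPartner

end Summit.BirchSwinnertonDyer.Rank1Residual.Additive

end
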